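import Literature.InformationTheory.QuantumCodes.StabilizerPastingXZ
import Literature.InformationTheory.QuantumCodes.DistanceTwoCodes
import Literature.InformationTheory.QuantumCodes.ConcatenatedCodes
import Literature.InformationTheory.QuantumCodes.QuantumHammingBoundDistanceThree
import HarnessLib

/-!
# The family `[8·m]`: pure `[[8m, 8m − ⌈log₂ m⌉ − 5, 3]]` codes stabilized by `X(8m)`, `Z(8m)` (Yu et al. 2013, §II)

Topic `Literature/InformationTheory/QuantumCodes` (venture QEC, cell `qec`; LIT-1 custody, the `d = 3` column,
constructions). S. Yu, J. Bierbrauer, Y. Dong, Q. Chen, C. H. Oh, *All the stabilizer codes of distance 3*, IEEE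
Trans. Inform. Theory 59 (2013) 5179 = arXiv:0901.1968 [YuEtAl2013], §II (lit chunk p0004 L55–94, read on the page
2026-08-27):

«Codes family `[8·m]` (`m ≥ 3`). The second family of codes are of parameters `[[8m, 8m − l_m − 5, 3]]` with
`l_m = ⌈log₂ m⌉` that are constructed in Ref. [li]. One crucial property of this family is that they are stabilized by
the all `X` and all `Z` observables `X(8m)` and `Z(8m)`. Here we shall provide a different construction based on
Gottesman's codes family. We divide `8m` qubits into `m` blocks of 8-qubit. First 5 stabilizer of the code are
`[2³]^{⊗m}` whose first two generators are `X(8m)` and `Z(8m)`. In the case of `m = 3, 4` the codes are defined in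
Table II. In the case of `m ≥ 5` so that `l_m ≥ 3`, the remaining `l_m` generators of the stabilizer are obtained
from Gottesman's code `[2^{l_m}]` by at first removing the first two generators and then removing arbitrary
`2^{l_m} − m` qubits and finally replacing each single-qubit Pauli operators `X, Y,` and `Z` in the remaining
stabilizers with corresponding 8-qubit operators `X(2³), Y(2³)`, and `Z(2³)` respectively. … Obviously all `l_m + 5`
generators defined above are commuting with each other. Because of the first 5 generators of the stabilizer any
2-errors in the same 8-qubit block can be detected. For any 2 errors in two different 8-qubit blocks, the last `l_m`
generators together with the first 2 generators defines a subcode of Gottesman's code `[2^{l_m}]` and therefore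
detects all 2 errors in different blocks. Thus all 2-error can be detected so that we have constructed a pure
1-error-correcting code of length `8m`.» The `m` remaining columns of Gottesman's check matrix `[H_m | A_m H_m]`
(«`H_m = [c_0, …, c_{2^m−1}]` with the `(k+1)`-th column `c_k` being the binary vector representing integer `k` and
`A_m` any invertible and fixed point free `m × m` matrix», p0004 L38–44) are what the last `l_m` generators read.

## Formalisation (all PROVED; no named facts, no `sorry`)

Qubits are `m` blocks of `2³ = 8` (the tree's `ofBlocks`/`toBlocks`/`blocksEquiv`, `ConcatenatedCodes.lean`). The
`8`-qubit code is the tree's `gottesmanCode G₃` (`[2³]`, CRSS Thm. 10, any fixed-point-free `G₃`); its generators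
repeated in every block are `blockDiag`. The cross-block generators are `crossGen A ι j` = «replace `X, Y, Z` by
`X(2³), Y(2³), Z(2³)`» (the tree's `encodeBlocks (allOmega 8) (allZ 8)`) applied to row `j` of the punctured check
matrix `[ι | A ι]`, where `ι : Fin m → 𝔽₂^l` (the kept columns) is ANY injection and `A` ANY invertible
fixed-point-free `l × l` matrix (`l ≥ 2`, `m ≤ 2^l`; `exists_fixedPointFree`). This uniform description covers the
printed `m ≥ 5` case (`l = l_m`, `ι` = binary numerals) and supplies codes with the printed parameters also for
`m = 3, 4` (`l = 2`), where the paper tabulates generators instead (Table II is not reproduced in our text source;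
the parameters `[[24,17,3]]`, `[[32,25,3]]` agree).

* `yuCode8m G₃ A ι` — the span of the `5 + l` generators in `Ē_{8m}`; `allOmega_mem_yuCode8m`, `allOnes_mem_yuCode8m`
  («stabilized by `X(8m)` and `Z(8m)`»).
* `isSelfOrthogonal_yuCode8m` («obviously all `l_m + 5` generators … are commuting»: every pairing reduces to
  pairings inside the self-orthogonal `[2³]`, which contains `X(2³)`, `Z(2³)`).
* `finrank_yuCode8m_le` — at most `l + 5` independent generators.
* `isPure_yuCode8m` — THE DISTANCE ARGUMENT: a Pauli word of weight `≤ 2` commuting with all generators is trivial: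
  inside one block by the purity of `[2³]`; across two blocks the first two generators force the two letters to be
  equal, and then the cross generators give `z·A(ι b₁ − ι b₂) + x·(ι b₁ − ι b₂) = 0`, impossible for `ι` injective,
  `A` injective and fixed-point-free («a subcode of Gottesman's code `[2^{l_m}]` … detects all 2 errors in different
  blocks»).
* **`YuEtAl2013_family_8m_of_le`**: `3 ≤ m`, `2 ≤ l`, `m ≤ 2^l` ⇒ `XZPureCodeExists (8m) (8m − (l + 5))` (a pure
  `[[8m, 8m − l − 5, 3]]` containing `X(8m)`, `(XZ)(8m)`; exact `k` by `XZPureCodeExists.anti`);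
  **`YuEtAl2013_family_8m`**: `3 ≤ m` ⇒ `XZPureCodeExists (8m) (8m − (Nat.clog 2 m + 5))`, i.e. the printed
  `[[8m, 8m − ⌈log₂ m⌉ − 5, 3]]`; instance `[[40,32,3]]` (`[8·3] = [[24,17,3]]` and `[8·4] = [[32,25,3]]` have the
  parameters of the census's kernel-certified `crssLowerPure_24_17` and of the tree's `pureAdditiveCodeExists_32_25_3` =
  Gottesman's `[2⁵]`; not restated — `YuEtAl2013_family_8m_of_le` with `l = 2` gives them as `XZPureCodeExists`).

Deliberately NOT here: optimality of `[8·m]` (the quantum Hamming bound comparison `l_m + 5 = s_H`, Remark after the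
construction) and Theorem 2 (separate file). Tree search (2026-08-27): `gottesmanCode`, `gottesmanGen`,
`CRSS1998_theorem10`, `exists_fixedPointFree`, `binVec`, `ofBlocks`, `toBlocks`, `sympWeight_ofBlocks`,
`sympInner_ofBlocks`, `encodeBlocks`, `allOmega`, `allOnes`, `sympInner_allOmega/allOnes`, `singleErr`,
`isSelfOrthogonal_span_range_iff`, `mem_sympDual_span_range_iff`, `XZPureCodeExists`, `allZ` (`Z^{⊗n}`,
`DistanceTwoCodes.lean`) — reused; no `[8·m]` family or
Li–Li 2004 codes in the tree.
-/

namespace Literature.InformationTheory.QuantumCodes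

open Finset Module Matrix

/-! ### 1. One-qubit bookkeeping: `Z^{⊗n}`, weight-one words -/

variable {n : ℕ}

/-- `(Z^{⊗n}).1 = 0` (`allZ n = (0…0 | 1…1)` is the tree's `Z^{⊗n}`, `DistanceTwoCodes.lean`). [cite: YuEtAl2013, §II (chunk p0004 L7-9: X(n), Z(n))] -/
@[simp] theorem allZ_fst (i : Fin n) : (allZ n).1 i = 0 := rfl

/-- `(Z^{⊗n}).2 = 1`. [cite: YuEtAl2013, §II (chunk p0004 L7-9)] -/
@[simp] theorem allZ_snd (i : Fin n) : (allZ n).2 i = 1 := rfl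

/-- `Z^{⊗n} = X^{⊗n} · (XZ)^{⊗n}`, i.e. `allZ = allOmega + allOnes` over `𝔽₂`. [cite: YuEtAl2013, §II (chunk p0004 L7-9)] -/
theorem allZ_eq_allOmega_add_allOnes (n : ℕ) : allZ n = allOmega n + allOnes n := by
  ext i
  · simp only [allZ_fst, Prod.fst_add, Pi.add_apply, allOmega_fst, allOnes_fst]; decide
  · simp only [allZ_snd, Prod.snd_add, Pi.add_apply, allOmega_snd, allOnes_snd]; decide

/-- `((X^{⊗n}, E)) = z` for a single-qubit error `E = (x|z)` at one qubit. [cite: Gottesman1997, §8.3 (chunk p0068 L14-18)] -/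
theorem sympInner_allOmega_singleErr (i : Fin n) (p : ZMod 2 × ZMod 2) :
    sympInner (allOmega n) (singleErr i p) = p.2 := by
  rw [sympInner_allOmega]
  exact Fintype.sum_pi_single' i p.2

/-- `((Z^{⊗n}, E)) = x` for a single-qubit error `E = (x|z)`. [cite: Gottesman1997, §8.3 (chunk p0068 L14-18)] -/
theorem sympInner_allZ_singleErr (i : Fin n) (p : ZMod 2 × ZMod 2) :
    sympInner (allZ n) (singleErr i p) = p.1 := by
  simp only [sympInner, dotProduct, allZ_fst, zero_mul, Finset.sum_const_zero, zero_add, allZ_snd, mul_one]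
  exact Fintype.sum_pi_single' i p.1

/-- `(((XZ)^{⊗n}, E)) = z + x`. [cite: Gottesman1997, §8.3 (chunk p0068 L14-18)] -/
theorem sympInner_allOnes_singleErr (i : Fin n) (p : ZMod 2 × ZMod 2) :
    sympInner (allOnes n) (singleErr i p) = p.2 + p.1 := by
  rw [sympInner_allOnes]
  simp only [singleErr]
  rw [Fintype.sum_pi_single' i p.2, Fintype.sum_pi_single' i p.1]

/-- **A word of weight one is a single-qubit error** `E = (x|z)_i`, `(x,z) ≠ (0,0)`. [cite: Gottesman1997, §7.1 (chunk p0055 L27-30: errors of weight one)] -/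
theorem exists_singleErr_of_sympWeight_eq_one {e : SympVec n} (h : sympWeight e = 1) :
    ∃ (i : Fin n) (p : ZMod 2 × ZMod 2), p ≠ 0 ∧ e = singleErr i p := by
  classical
  unfold sympWeight at h
  obtain ⟨i, hi⟩ := Finset.card_eq_one.1 h
  have hoff : ∀ j, j ≠ i → e.1 j = 0 ∧ e.2 j = 0 := fun j hj => by
    have : j ∉ ({i} : Finset (Fin n)) := by simpa using hj
    rw [← hi] at this
    simpa [not_or] using this
  have hin : e.1 i ≠ 0 ∨ e.2 i ≠ 0 := by
    have : i ∈ ({i} : Finset (Fin n)) := Finset.mem_singleton_self i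
    rw [← hi] at this
    simpa using this
  refine ⟨i, (e.1 i, e.2 i), fun h0 => ?_, ?_⟩
  · simp only [Prod.mk_eq_zero] at h0
    tauto
  · ext j
    · by_cases hj : j = i
      · subst hj; simp [singleErr]
      · simp [singleErr, hj, (hoff j hj).1]
    · by_cases hj : j = i
      · subst hj; simp [singleErr]
      · simp [singleErr, hj, (hoff j hj).2]

/-! ### 2. The generators -/

section Construction

variable {m l : ℕ}

/-- **Block-diagonal repetition** of an 8-qubit word: the same Pauli word on every block («First 5 stabilizer of the
code are `[2³]^{⊗m}`»). [cite: YuEtAl2013, §II (chunk p0004 L62-64)] -/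
def blockDiag (m : ℕ) (g : SympVec (2 ^ 3)) : SympVec (m * 2 ^ 3) := ofBlocks fun _ : Fin m => g

/-- Row `j` of the punctured check matrix `[ι | A ι]` as an `m`-qubit Pauli word: on block-index `b` the letter with
`z`-bit `(ι b)_j` and `x`-bit `(A ι b)_j` (Gottesman's `[H_m | A_m H_m]` restricted to the kept columns `ι`).
[cite: YuEtAl2013, §II (chunk p0004 L38-44, L64-70)] -/
def crossRow (A : Matrix (Fin l) (Fin l) (ZMod 2)) (ι : Fin m → (Fin l → ZMod 2)) (j : Fin l) : SympVec m :=
  (fun b => (A *ᵥ ι b) j, fun b => ι b j)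

/-- **Cross-block generator** `j`: row `j` of `[ι | A ι]` with «each single-qubit Pauli operators `X, Y,` and `Z` …
[replaced] with corresponding 8-qubit operators `X(2³), Y(2³)`, and `Z(2³)`» — block `b` carries
`(A ι b)_j · X(2³) + (ι b)_j · Z(2³)`. [cite: YuEtAl2013, §II (chunk p0004 L64-70)] -/
def crossGen (A : Matrix (Fin l) (Fin l) (ZMod 2)) (ι : Fin m → (Fin l → ZMod 2)) (j : Fin l) :
    SympVec (m * 2 ^ 3) :=
  ofBlocks (encodeBlocks (allOmega (2 ^ 3)) (allZ (2 ^ 3)) (crossRow A ι j))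

/-- The `5 + l` generators of `[8·m]`: the five generators of `[2³]` block-diagonally, then the `l` cross-block rows.
[cite: YuEtAl2013, §II (chunk p0004 L62-70)] -/
def yuGen8m (G₃ : Matrix (Fin 3) (Fin 3) (ZMod 2)) (A : Matrix (Fin l) (Fin l) (ZMod 2))
    (ι : Fin m → (Fin l → ZMod 2)) : (Fin 2 ⊕ Fin 3) ⊕ Fin l → SympVec (m * 2 ^ 3)
  | Sum.inl x => blockDiag m (gottesmanGen G₃ x)
  | Sum.inr j => crossGen A ι j

/-- **The code `[8·m]`** (block form `m × 2³`): the span of `yuGen8m`. [cite: YuEtAl2013, §II (chunk p0004 L55-70)] -/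
def yuCode8m (G₃ : Matrix (Fin 3) (Fin 3) (ZMod 2)) (A : Matrix (Fin l) (Fin l) (ZMod 2))
    (ι : Fin m → (Fin l → ZMod 2)) : Submodule (ZMod 2) (SympVec (m * 2 ^ 3)) :=
  Submodule.span (ZMod 2) (Set.range (yuGen8m G₃ A ι))

variable (G₃ : Matrix (Fin 3) (Fin 3) (ZMod 2)) (A : Matrix (Fin l) (Fin l) (ZMod 2)) (ι : Fin m → (Fin l → ZMod 2))

/-- `blockDiag (ωω…ω) = X(8m)`. [cite: YuEtAl2013, §II (chunk p0004 L62-64: «whose first two generators are X(8m) and Z(8m)»)] -/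
theorem blockDiag_allOmega : blockDiag m (allOmega (2 ^ 3)) = allOmega (m * 2 ^ 3) := rfl

/-- `blockDiag (11…1) = (XZ)(8m)`. [cite: YuEtAl2013, §II (chunk p0004 L62-64)] -/
theorem blockDiag_allOnes : blockDiag m (allOnes (2 ^ 3)) = allOnes (m * 2 ^ 3) := rfl

/-- `X(8m) ∈ [8·m]` (generator `inl (inl 0)`). [cite: YuEtAl2013, §II (chunk p0004 L58-60: «stabilized by … X(8m) and Z(8m)»)] -/
theorem allOmega_mem_yuCode8m : allOmega (m * 2 ^ 3) ∈ yuCode8m G₃ A ι :=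
  Submodule.subset_span ⟨Sum.inl (Sum.inl 0), rfl⟩

/-- `(XZ)(8m) ∈ [8·m]` (generator `inl (inl 1)`). [cite: YuEtAl2013, §II (chunk p0004 L58-60)] -/
theorem allOnes_mem_yuCode8m : allOnes (m * 2 ^ 3) ∈ yuCode8m G₃ A ι :=
  Submodule.subset_span ⟨Sum.inl (Sum.inl 1), rfl⟩

/-! ### 3. Commutation («obviously all `l_m + 5` generators … are commuting») -/

/-- `Z(2³) ∈ [2³]`. [cite: YuEtAl2013, §II (chunk p0004 L33-36)] -/
theorem allZ_mem_gottesmanCode : allZ (2 ^ 3) ∈ gottesmanCode G₃ := by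
  rw [allZ_eq_allOmega_add_allOnes]
  exact (gottesmanCode G₃).add_mem (Submodule.subset_span ⟨Sum.inl 0, rfl⟩) (Submodule.subset_span ⟨Sum.inl 1, rfl⟩)

/-- Pairing a word of `[2³]` with an encoded letter `a·X(2³) + c·Z(2³)` gives `0` (`[2³]` is abelian and contains
`X(2³)`, `Z(2³)`). [cite: YuEtAl2013, §II (chunk p0004 L72-73)] -/
theorem sympInner_mem_encode_eq_zero {g : SympVec (2 ^ 3)} (hg : g ∈ gottesmanCode G₃) (a c : ZMod 2) :
    sympInner g (a • allOmega (2 ^ 3) + c • allZ (2 ^ 3)) = 0 := by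
  have hso := isSelfOrthogonal_gottesmanCode le_rfl G₃
  have hX : sympInner (allOmega (2 ^ 3)) g = 0 :=
    mem_sympDual_iff.1 (hso hg) _ (Submodule.subset_span ⟨Sum.inl 0, rfl⟩)
  have hZ : sympInner (allZ (2 ^ 3)) g = 0 := mem_sympDual_iff.1 (hso hg) _ (allZ_mem_gottesmanCode G₃)
  rw [sympInner_comm, sympInner_add_left, sympInner_smul_left, sympInner_smul_left, hX, hZ, mul_zero, mul_zero,
    add_zero]

/-- **All generators commute.** [cite: YuEtAl2013, §II (chunk p0004 L72-73: «Obviously all l_m+5 generators defined above are commuting with each other»)] -/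
theorem sympInner_yuGen8m (x y : (Fin 2 ⊕ Fin 3) ⊕ Fin l) : sympInner (yuGen8m G₃ A ι x) (yuGen8m G₃ A ι y) = 0 := by
  have hso := isSelfOrthogonal_gottesmanCode le_rfl G₃
  have hgen : ∀ z, gottesmanGen G₃ z ∈ gottesmanCode G₃ := fun z => Submodule.subset_span ⟨z, rfl⟩
  rcases x with x | j <;> rcases y with y | j'
  · -- diag / diag
    simp only [yuGen8m, blockDiag, sympInner_ofBlocks]
    exact Finset.sum_eq_zero fun b _ => mem_sympDual_iff.1 (hso (hgen y)) _ (hgen x)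
  · -- diag / cross
    simp only [yuGen8m, blockDiag, crossGen, sympInner_ofBlocks, encodeBlocks_apply]
    exact Finset.sum_eq_zero fun b _ => sympInner_mem_encode_eq_zero G₃ (hgen x) _ _
  · -- cross / diag
    rw [sympInner_comm]
    simp only [yuGen8m, blockDiag, crossGen, sympInner_ofBlocks, encodeBlocks_apply]
    exact Finset.sum_eq_zero fun b _ => sympInner_mem_encode_eq_zero G₃ (hgen y) _ _
  · -- cross / cross
    simp only [yuGen8m, crossGen, sympInner_ofBlocks, encodeBlocks_apply]
    refine Finset.sum_eq_zero fun b _ => sympInner_mem_encode_eq_zero G₃ ?_ _ _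
    exact (gottesmanCode G₃).add_mem ((gottesmanCode G₃).smul_mem _ (hgen (Sum.inl 0)))
      ((gottesmanCode G₃).smul_mem _ (allZ_mem_gottesmanCode G₃))

/-- `[8·m]` is self-orthogonal (an abelian stabilizer). [cite: YuEtAl2013, §II (chunk p0004 L72-73)] -/
theorem isSelfOrthogonal_yuCode8m : IsSelfOrthogonal (yuCode8m G₃ A ι) :=
  (isSelfOrthogonal_span_range_iff _).2 (sympInner_yuGen8m G₃ A ι)

/-- At most `l + 5` independent generators. [cite: YuEtAl2013, §II (chunk p0004 L72: «all l_m + 5 generators»)] -/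
theorem finrank_yuCode8m_le : finrank (ZMod 2) (yuCode8m G₃ A ι) ≤ l + 5 := by
  have h := finrank_range_le_card (R := ZMod 2) (yuGen8m G₃ A ι)
  simp only [Set.finrank, Fintype.card_sum, Fintype.card_fin] at h
  rw [yuCode8m]
  omega

/-! ### 4. Purity to distance three -/

/-- Syndrome of a block word `W` against a block-diagonal generator: `Σ_b ((g, W_b))`.
[cite: YuEtAl2013, §II (chunk p0004 L73-75)] -/
theorem sympInner_blockDiag_ofBlocks (g : SympVec (2 ^ 3)) (W : Fin m → SympVec (2 ^ 3)) :
    sympInner (blockDiag m g) (ofBlocks W) = ∑ b, sympInner g (W b) := by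
  rw [blockDiag, sympInner_ofBlocks]

/-- Syndrome against a cross generator: `Σ_b ((A ι b)_j ((X(2³), W_b)) + (ι b)_j ((Z(2³), W_b)))`.
[cite: YuEtAl2013, §II (chunk p0004 L75-78)] -/
theorem sympInner_crossGen_ofBlocks (j : Fin l) (W : Fin m → SympVec (2 ^ 3)) :
    sympInner (crossGen A ι j) (ofBlocks W)
      = ∑ b, ((A *ᵥ ι b) j * sympInner (allOmega (2 ^ 3)) (W b) + ι b j * sympInner (allZ (2 ^ 3)) (W b)) := by
  rw [crossGen, sympInner_ofBlocks]
  refine Finset.sum_congr rfl fun b _ => ?_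
  rw [encodeBlocks_apply, sympInner_add_left, sympInner_smul_left, sympInner_smul_left]
  rfl

/-- **Errors inside one block are detected by `[2³]^{⊗m}`**: a block word supported on a single block `b₀`, of weight
`≤ 2`, orthogonal to the five block-diagonal generators, vanishes (purity of `[2³]`).
[cite: YuEtAl2013, §II (chunk p0004 L73-75: «Because of the first 5 generators … any 2-errors in the same 8-qubit block can be detected»)] -/
theorem eq_zero_of_single_block (hG : ∀ c, G₃ *ᵥ c = 0 → c = 0) (hfix : ∀ c, G₃ *ᵥ c = c → c = 0)
    {W : Fin m → SympVec (2 ^ 3)} {b₀ : Fin m} (hoff : ∀ b, b ≠ b₀ → W b = 0)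
    (hwt : sympWeight (W b₀) ≤ 2) (horth : ∀ x : Fin 2 ⊕ Fin 3, ∑ b, sympInner (gottesmanGen G₃ x) (W b) = 0) :
    W = 0 := by
  have hpure := (CRSS1998_theorem10 le_rfl G₃ hG hfix).2
  have hb₀ : ∀ x, sympInner (gottesmanGen G₃ x) (W b₀) = 0 := fun x => by
    rw [← horth x, Finset.sum_eq_single b₀ (fun b _ hb => by rw [hoff b hb, ← sympForm_apply, map_zero]) (by simp)]
  have hdual : W b₀ ∈ sympDual (gottesmanCode G₃) := (mem_sympDual_span_range_iff _ _).2 hb₀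
  have hzero : W b₀ = 0 := by
    by_contra hne
    have := hpure _ hdual hne
    omega
  funext b
  by_cases hb : b = b₀
  · rw [hb, hzero]; rfl
  · exact hoff b hb

/-- **Two single errors in different blocks are detected**: if `W_{b₁} = E₁`, `W_{b₂} = E₂` are single-qubit errors in
distinct blocks (all other blocks trivial) and `W` is orthogonal to `X(8m)`, `(XZ)(8m)` and the `l` cross generators,
contradiction — `X(8m), Z(8m)` force the same letter `(x|z)` in both blocks, and then row `j` reads
`z·(A(ι b₁ + ι b₂))_j + x·(ι b₁ + ι b₂)_j = 0` for all `j`, i.e. `δ = ι b₁ + ι b₂ ≠ 0` satisfies `δ = 0` (`X`),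
`Aδ = 0` (`Z`) or `Aδ = δ` (`Y`). [cite: YuEtAl2013, §II (chunk p0004 L75-79: «the last l_m generators together with the first 2 generators defines a subcode of Gottesman's code [2^{l_m}] and therefore detects all 2 errors in different blocks»)] -/
theorem false_of_two_blocks (hA : ∀ c, A *ᵥ c = 0 → c = 0) (hAfix : ∀ c, A *ᵥ c = c → c = 0)
    (hι : Function.Injective ι) {b₁ b₂ : Fin m} (hb : b₁ ≠ b₂) {i₁ i₂ : Fin (2 ^ 3)} {p₁ p₂ : ZMod 2 × ZMod 2}
    (hp₁ : p₁ ≠ 0) {W : Fin m → SympVec (2 ^ 3)} (hW₁ : W b₁ = singleErr i₁ p₁) (hW₂ : W b₂ = singleErr i₂ p₂)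
    (hoff : ∀ b, b ≠ b₁ → b ≠ b₂ → W b = 0)
    (hX : ∑ b, sympInner (allOmega (2 ^ 3)) (W b) = 0) (hY : ∑ b, sympInner (allOnes (2 ^ 3)) (W b) = 0)
    (hcross : ∀ j, ∑ b, ((A *ᵥ ι b) j * sympInner (allOmega (2 ^ 3)) (W b)
      + ι b j * sympInner (allZ (2 ^ 3)) (W b)) = 0) : False := by
  -- reduce the sums to the two blocks
  have hsum2 : ∀ F : SympVec (2 ^ 3) → Fin m → ZMod 2, (∀ b, F 0 b = 0) →
      ∑ b, F (W b) b = F (W b₁) b₁ + F (W b₂) b₂ := by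
    intro F hF0
    rw [← Finset.sum_subset (Finset.subset_univ ({b₁, b₂} : Finset (Fin m)))
      (fun b _ hb2 => by
        simp only [Finset.mem_insert, Finset.mem_singleton, not_or] at hb2
        rw [hoff b hb2.1 hb2.2, hF0]),
      Finset.sum_pair hb]
  have h0 : ∀ v : SympVec (2 ^ 3), sympInner v 0 = 0 := fun v => by rw [sympInner_comm, sympInner_zero_left]
  have eX := hsum2 (fun v _ => sympInner (allOmega (2 ^ 3)) v) (fun _ => h0 _)
  have eY := hsum2 (fun v _ => sympInner (allOnes (2 ^ 3)) v) (fun _ => h0 _)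
  rw [eX, hW₁, hW₂, sympInner_allOmega_singleErr, sympInner_allOmega_singleErr] at hX
  rw [eY, hW₁, hW₂, sympInner_allOnes_singleErr, sympInner_allOnes_singleErr] at hY
  -- the two letters coincide
  have h2 : p₂.2 = p₁.2 := by
    have : p₁.2 + p₂.2 = 0 := hX
    have h' : ∀ a b : ZMod 2, a + b = 0 → b = a := by decide
    exact h' _ _ this
  have h1 : p₂.1 = p₁.1 := by
    have : p₁.2 + p₁.1 + (p₂.2 + p₂.1) = 0 := hY
    rw [h2] at this
    have h' : ∀ a b c : ZMod 2, a + b + (a + c) = 0 → c = b := by decide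
    exact h' _ _ _ this
  -- the cross rows: `z·A δ + x·δ = 0`
  set δ : Fin l → ZMod 2 := ι b₁ + ι b₂ with hδ
  have hδ0 : δ ≠ 0 := by
    intro h0
    apply hb
    apply hι
    have h' : ∀ u v : Fin l → ZMod 2, u + v = 0 → u = v := fun u v huv => by
      funext j; have := congrFun huv j; simp only [Pi.add_apply, Pi.zero_apply] at this
      have h'' : ∀ a b : ZMod 2, a + b = 0 → a = b := by decide
      exact h'' _ _ this
    exact h' _ _ h0
  have hrow : ∀ j, p₁.2 * (A *ᵥ δ) j + p₁.1 * δ j = 0 := by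
    intro j
    have e := hsum2 (fun v b => (A *ᵥ ι b) j * sympInner (allOmega (2 ^ 3)) v + ι b j * sympInner (allZ (2 ^ 3)) v)
      (fun b => by rw [h0, h0, mul_zero, mul_zero, add_zero])
    have hc := hcross j
    rw [e, hW₁, hW₂, sympInner_allOmega_singleErr, sympInner_allOmega_singleErr, sympInner_allZ_singleErr,
      sympInner_allZ_singleErr, h1, h2] at hc
    rw [hδ, mulVec_add]
    simp only [Pi.add_apply]
    linear_combination hc
  -- case analysis on the letter `(x|z) = p₁ ≠ 0`
  have hvec : p₁.2 • (A *ᵥ δ) + p₁.1 • δ = 0 := by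
    funext j; simpa [Pi.add_apply, Pi.smul_apply, smul_eq_mul] using hrow j
  have hcases : ∀ q : ZMod 2 × ZMod 2, q ≠ 0 → q = (1, 0) ∨ q = (0, 1) ∨ q = (1, 1) := by decide
  rcases hcases p₁ hp₁ with hq | hq | hq <;> rw [hq] at hvec <;> simp only [one_smul, zero_smul, zero_add,
    add_zero] at hvec
  · exact hδ0 hvec
  · exact hδ0 (hA δ hvec)
  · refine hδ0 (hAfix δ ?_)
    have h' : ∀ u v : Fin l → ZMod 2, u + v = 0 → u = v := fun u v huv => by
      funext j; have := congrFun huv j; simp only [Pi.add_apply, Pi.zero_apply] at this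
      have h'' : ∀ a b : ZMod 2, a + b = 0 → a = b := by decide
      exact h'' _ _ this
    exact h' _ _ hvec

/-- **`[8·m]` is pure to distance 3** («all 2-error can be detected so that we have constructed a pure
1-error-correcting code of length `8m`»), for `G₃` fixed-point-free invertible (`[2³]`), `A` fixed-point-free
invertible and `ι` injective. [cite: YuEtAl2013, §II (chunk p0004 L72-79)] -/
theorem isPure_yuCode8m (hG : ∀ c, G₃ *ᵥ c = 0 → c = 0) (hfix : ∀ c, G₃ *ᵥ c = c → c = 0)
    (hA : ∀ c, A *ᵥ c = 0 → c = 0) (hAfix : ∀ c, A *ᵥ c = c → c = 0) (hι : Function.Injective ι) :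
    IsPure (yuCode8m G₃ A ι) 3 := by
  classical
  intro w hw hw0
  by_contra hlt
  rw [not_le] at hlt
  -- block form
  set W := toBlocks w with hWdef
  have hwW : w = ofBlocks W := (ofBlocks_toBlocks w).symm
  have horth : ∀ x, sympInner (yuGen8m G₃ A ι x) w = 0 := (mem_sympDual_span_range_iff _ _).1 hw
  have hdiag : ∀ x : Fin 2 ⊕ Fin 3, ∑ b, sympInner (gottesmanGen G₃ x) (W b) = 0 := fun x => by
    rw [← sympInner_blockDiag_ofBlocks, ← hwW]; exact horth (Sum.inl x)
  have hcross : ∀ j, ∑ b, ((A *ᵥ ι b) j * sympInner (allOmega (2 ^ 3)) (W b)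
      + ι b j * sympInner (allZ (2 ^ 3)) (W b)) = 0 := fun j => by
    rw [← sympInner_crossGen_ofBlocks, ← hwW]; exact horth (Sum.inr j)
  have hwt : ∑ b, sympWeight (W b) ≤ 2 := by
    rw [← sympWeight_ofBlocks, ← hwW]; omega
  have hW0 : W ≠ 0 := fun h0 => hw0 (by rw [hwW, h0]; rfl)
  -- the nonzero blocks
  obtain ⟨b₁, hb₁⟩ : ∃ b, W b ≠ 0 := by
    by_contra h
    exact hW0 (funext fun b => not_not.1 fun hb => h ⟨b, hb⟩)
  by_cases hone : ∀ b, b ≠ b₁ → W b = 0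
  · -- a single block
    have hwt₁ : sympWeight (W b₁) ≤ 2 :=
      (Finset.single_le_sum (fun b _ => Nat.zero_le (sympWeight (W b))) (Finset.mem_univ b₁)).trans hwt
    exact hW0 (eq_zero_of_single_block G₃ hG hfix hone hwt₁ hdiag)
  · -- two blocks, each of weight one
    obtain ⟨b₂, hb₂₁, hb₂⟩ : ∃ b, b ≠ b₁ ∧ W b ≠ 0 := by
      by_contra h'
      exact hone fun b hb => not_not.1 fun hWb => h' ⟨b, hb, hWb⟩
    have hpos : ∀ b, W b ≠ 0 → 1 ≤ sympWeight (W b) := fun b hb =>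
      Nat.one_le_iff_ne_zero.2 fun h0 => hb ((sympWeight_eq_zero_iff _).1 h0)
    have hpair : sympWeight (W b₁) + sympWeight (W b₂) ≤ ∑ b, sympWeight (W b) := by
      rw [← Finset.sum_pair (f := fun b => sympWeight (W b)) (Ne.symm hb₂₁)]
      exact Finset.sum_le_sum_of_subset_of_nonneg (Finset.subset_univ _) fun _ _ _ => Nat.zero_le _
    have h1 := hpos b₁ hb₁
    have h2 := hpos b₂ hb₂
    have hw₁ : sympWeight (W b₁) = 1 := by omega
    have hw₂ : sympWeight (W b₂) = 1 := by omega
    -- every other block vanishes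
    have hoff : ∀ b, b ≠ b₁ → b ≠ b₂ → W b = 0 := by
      intro b hb1 hb2
      by_contra hb0
      have h3 := hpos b hb0
      have htriple : sympWeight (W b₁) + sympWeight (W b₂) + sympWeight (W b)
          ≤ ∑ b, sympWeight (W b) := by
        have hsub : ({b₁, b₂, b} : Finset (Fin m)) ⊆ Finset.univ := Finset.subset_univ _
        have := Finset.sum_le_sum_of_subset_of_nonneg hsub (f := fun b => sympWeight (W b))
          fun _ _ _ => Nat.zero_le _
        rw [Finset.sum_insert (by simp [Ne.symm hb₂₁, Ne.symm hb1]), Finset.sum_pair (Ne.symm hb2)] at this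
        simpa [add_assoc] using this
      omega
    obtain ⟨i₁, p₁, hp₁, hW₁⟩ := exists_singleErr_of_sympWeight_eq_one hw₁
    obtain ⟨i₂, p₂, -, hW₂⟩ := exists_singleErr_of_sympWeight_eq_one hw₂
    exact false_of_two_blocks A ι hA hAfix hι (Ne.symm hb₂₁) hp₁ hW₁ hW₂ hoff (hdiag (Sum.inl 0))
      (hdiag (Sum.inl 1)) hcross

/-! ### 5. The family -/

/-- **`[8·m]` with chosen data**: for `G₃`, `A` fixed-point-free invertible and `ι` injective, `yuCode8m G₃ A ι` is a
pure `[[8m, 8m − dim, 3]]` code with `dim ≤ l + 5`, containing `X(8m)` and `(XZ)(8m)`.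
[cite: YuEtAl2013, §II (chunk p0004 L55-79)] -/
theorem yuCode8m_isCode (hG : ∀ c, G₃ *ᵥ c = 0 → c = 0) (hfix : ∀ c, G₃ *ᵥ c = c → c = 0)
    (hA : ∀ c, A *ᵥ c = 0 → c = 0) (hAfix : ∀ c, A *ᵥ c = c → c = 0) (hι : Function.Injective ι) :
    IsAdditiveCode (yuCode8m G₃ A ι) (m * 2 ^ 3 - finrank (ZMod 2) (yuCode8m G₃ A ι)) 3 ∧
      IsPure (yuCode8m G₃ A ι) 3 := by
  have hpure := isPure_yuCode8m G₃ A ι hG hfix hA hAfix hι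
  have hso := isSelfOrthogonal_yuCode8m G₃ A ι
  have hle : finrank (ZMod 2) (yuCode8m G₃ A ι) ≤ m * 2 ^ 3 := by
    have := Submodule.finrank_le (yuCode8m G₃ A ι)
    rw [finrank_sympVec] at this
    -- self-orthogonal ⇒ `dim ≤ n` (from `dim S̄ + dim S̄⊥ = 2n`, `S̄ ≤ S̄⊥`)
    have h2 := finrank_sympDual_add (yuCode8m G₃ A ι)
    have h3 := Submodule.finrank_mono hso
    omega
  exact ⟨⟨hso, by omega, hpure.hasMinDist, fun _ v hv hv0 => hpure v (hso hv) hv0⟩, hpure⟩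

/-- **The family `[8·m]`, uniform version**: for `m ≥ 3` (indeed `m ≥ 1`) and any `l ≥ 2` with `m ≤ 2^l` there is
a pure `[[8m, 8m − (l + 5), 3]]` code containing `X(8m)` and `(XZ)(8m)` (the `m` blocks labelled by distinct vectors
of `𝔽₂^l`, `A` fixed-point-free invertible of size `l`; `l ≥ 2` is needed for such `A` to exist).
[cite: YuEtAl2013, §II (chunk p0004 L55-79)] -/
theorem YuEtAl2013_family_8m_of_le {m l : ℕ} (_hm : 1 ≤ m) (hl : 2 ≤ l) (hml : m ≤ 2 ^ l) :
    XZPureCodeExists (8 * m) (8 * m - (l + 5)) := by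
  obtain ⟨G₃, hG, hfix⟩ := exists_fixedPointFree (m := 3) (by norm_num)
  obtain ⟨A, hA, hAfix⟩ := exists_fixedPointFree (m := l) hl
  let ι : Fin m → (Fin l → ZMod 2) := fun b => binVec l (Fin.castLE hml b)
  have hι : Function.Injective ι := (binVec l).injective.comp (Fin.castLE_injective hml)
  obtain ⟨hcode, hpure⟩ := yuCode8m_isCode G₃ A ι hG hfix hA hAfix hι
  have hrank := finrank_yuCode8m_le G₃ A ι
  have h8 : m * 2 ^ 3 = 8 * m := by ring
  have hXZ : XZPureCodeExists (m * 2 ^ 3) (m * 2 ^ 3 - finrank (ZMod 2) (yuCode8m G₃ A ι)) :=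
    ⟨yuCode8m G₃ A ι, hcode, hpure, allOmega_mem_yuCode8m G₃ A ι, allOnes_mem_yuCode8m G₃ A ι⟩
  obtain ⟨r, hr⟩ : ∃ r, finrank (ZMod 2) (yuCode8m G₃ A ι) = r := ⟨_, rfl⟩
  rw [hr] at hXZ hrank
  rw [h8] at hXZ
  exact hXZ.anti (by omega)

/-- `m ≤ 2^{⌈log₂ m⌉}` and `⌈log₂ m⌉ ≥ 2` for `m ≥ 3` (`l_m = ⌈log₂ m⌉ = Nat.clog 2 m`). [cite: YuEtAl2013, §II (chunk p0004 L56-57: l_m = ⌈log₂ m⌉)] -/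
theorem two_le_clog_of_three_le {m : ℕ} (hm : 3 ≤ m) : 2 ≤ Nat.clog 2 m := by
  by_contra h
  have h1 : Nat.clog 2 m ≤ 1 := by omega
  have := Nat.le_pow_clog (by norm_num : 1 < 2) m
  have h2 : 2 ^ Nat.clog 2 m ≤ 2 ^ 1 := Nat.pow_le_pow_right (by norm_num) h1
  omega

/-- **Codes family `[8·m]` (Yu–Bierbrauer–Dong–Chen–Oh 2013, §II; Li–Li 2004)**: for every `m ≥ 3` there is a pure
`[[8m, 8m − l_m − 5, 3]]` stabilizer code, `l_m = ⌈log₂ m⌉`, «stabilized by the all `X` and all `Z` observables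
`X(8m)` and `Z(8m)`» — a left factor for the stabilizer pasting (`XZPureCodeExists`).
[cite: YuEtAl2013, §II (chunk p0004 L55-60)] -/
theorem YuEtAl2013_family_8m {m : ℕ} (hm : 3 ≤ m) : XZPureCodeExists (8 * m) (8 * m - (Nat.clog 2 m + 5)) :=
  YuEtAl2013_family_8m_of_le (by omega) (two_le_clog_of_three_le hm) (Nat.le_pow_clog (by norm_num) m)

/-- `[8·5] = [[40,32,3]]` (pure; `l_5 = 3`; one logical qubit below the perfect `[[40,33,3]]` — «some of them are not
optimal»). [cite: YuEtAl2013, §II (chunk p0004 L81-87)] -/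
theorem pureAdditiveCodeExists_40_32_3 : PureAdditiveCodeExists 40 32 3 :=
  (YuEtAl2013_family_8m_of_le (m := 5) (l := 3) (by norm_num) (by norm_num) (by norm_num)).pure

end Construction

end Literature.InformationTheory.QuantumCodes
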